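import Summits.KontsevichZagierPeriods.KontsevichZagierPeriods.Theorems.SoloBlindQuarticTwist
import HarnessLib

/-!
# Quartic family, second kind — part I: integrands, pull-backs and the primitive

Sol Binde (solo-blind track), 2026-08-20.

The SECOND-KIND splittings of the Aoki–Shioda quartic family are realised on the same quartic
correspondence (`φ_A, φ_B, ψ` of `SoloBlindQuarticPrep`), but — exactly as for triplication of
the second kind — no pointwise identity exists on the real branch `m ∈ (0,1)`: one
Newton–Leibniz (exact-form) move is needed.  For `0 < y < 1/4` the three Beta integrands

* `β(4y, 1-3y)`  along `φ_A` ↦ `G_A = Φ^{-y}(3m²-2m+1)/A`,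
* `β(1-y, 4y)`   along `φ_B` ↦ `G_B = Φ^{-y} m²(m²-2m+3)/(A(m²-m+1))`,
* `β(1-3y, ½+y)` along `ψ`   ↦ `G_C = 64^{-y}Φ^{-y}·4(1+m)(1-m)/(1+m²)²`

satisfy, with the primitive `P(m) = Φ(m)^{-y}·m/(1+m²)` (`P(0⁺) = P(1⁻) = 0`),

  `P' = ((1-4y)/4)·64^{y}·G_C - 3y·G_B + y·G_A`   on `(0,1)`,

found by exact rational linear algebra.  This file: the integrands, the three pull-back
identities, integrability, semialgebraicity, the primitive in manifestly continuous form and its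
derivative.  Part II assembles `3y•β(1-y,4y) - y•β(4y,1-3y) = ((1-4y)/4)64^{y} • β(1-3y, ½+y)`.
-/

open MeasureTheory Set Real MvPolynomial
open Literature.NumberTheory.Transcendental
open Literature.NumberTheory.Transcendental.KZ
open Literature.NumberTheory.Transcendental.KZ.IntegralRep

noncomputable section

namespace Summit.KontsevichZagierPeriods.KontsevichZagierPeriods.Theorems

namespace SoloBlind

variable {y : ℚ}

/-! ## The pulled-back integrands and the exact integrand -/

/-- `G_A(y,m) = Φ^{-y}(3m²-2m+1)/A`. -/
def qsGA (y : ℚ) (m : ℝ) : ℝ := quPhi m ^ (-(y : ℝ)) * (3 * m ^ 2 - 2 * m + 1) / quA m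

/-- `G_B(y,m) = Φ^{-y} m²(m²-2m+3)/(A(m²-m+1))`. -/
def qsGB (y : ℚ) (m : ℝ) : ℝ :=
  quPhi m ^ (-(y : ℝ)) * (m ^ 2 * (m ^ 2 - 2 * m + 3)) / (quA m * (m ^ 2 - m + 1))

/-- `G_C(y,m) = 64^{-y}·Φ^{-y}·4(1+m)(1-m)/(1+m²)²`. -/
def qsGC (y : ℚ) (m : ℝ) : ℝ :=
  (64:ℝ) ^ (-(y : ℝ)) * (quPhi m ^ (-(y : ℝ)) * (4 * (1 + m) * (1 - m)) / (1 + m ^ 2) ^ 2)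

/-- The exact integrand `P' = ((1-4y)/4)64^y G_C - 3y G_B + y G_A` on `(0,1)`, extended by `0`. -/
def qsE (y : ℚ) (m : ℝ) : ℝ :=
  if m ∈ Ioo (0:ℝ) 1 then
    ((((1 - 4 * y) / 4 : ℚ)) : ℝ) * ((64:ℝ) ^ (y : ℝ) * qsGC y m) +
      ((((-(3 * y) : ℚ)) : ℝ) * qsGB y m + ((y : ℚ) : ℝ) * qsGA y m)
  else 0

/-- The primitive `P(m) = (1-m)^{4y}(1+m²)^{4y-1} m^{1-3y}/(m²-m+1)^{3y}` (continuous form). -/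
def qsP (y : ℚ) (m : ℝ) : ℝ :=
  (1 - m) ^ (4 * (y : ℝ)) * (1 + m ^ 2) ^ (4 * (y : ℝ) - 1) * m ^ (1 - 3 * (y : ℝ)) /
    (m ^ 2 - m + 1) ^ (3 * (y : ℝ))

/-- `Φ'(m) = D²(3m²-2m+1)(3A+4D)/A⁵`. -/
def quPhi' (m : ℝ) : ℝ :=
  quD m ^ 2 * (3 * m ^ 2 - 2 * m + 1) * (3 * quA m + 4 * quD m) / quA m ^ 5

/-! ## The pull-back identities -/

/-- **Pull-back along `φ_A`:** `G_A = σ^{4y-1}(1-σ)^{-3y}|φ_A'|`, `σ = φ_A(m)`. -/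
theorem qs_pullA (y : ℚ) {m : ℝ} (hm : m ∈ Ioo (0:ℝ) 1) :
    qsGA y m = betaFun (4 * y) (1 - 3 * y) (quA m) * |quA' m| := by
  have hA := quA_pos hm
  have hD := quD_pos hm
  have hΦ := quPhi_pos hm
  rw [betaFun, show (((4 * y : ℚ)) : ℝ) - 1 = ((4:ℤ) : ℝ) * (y : ℝ) + (-1) by push_cast; ring,
    show (((1 - 3 * y : ℚ)) : ℝ) - 1 = ((-3:ℤ) : ℝ) * (y : ℝ) + 0 by push_cast; ring,
    one_sub_quA, qu_master hA hD, qt_keyA hm, Real.inv_rpow hΦ.le, ← Real.rpow_neg hΦ.le,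
    Real.rpow_neg_one, Real.rpow_zero, abs_quA']
  unfold qsGA
  rw [div_eq_mul_inv]
  ring

/-- **Pull-back along `φ_B`:** `G_B = σ^{-y}(1-σ)^{4y-1}|φ_B'|`, `σ = φ_B(m)`. -/
theorem qs_pullB (y : ℚ) {m : ℝ} (hm : m ∈ Ioo (0:ℝ) 1) :
    qsGB y m = betaFun (1 - y) (4 * y) (quB m) * |quB' m| := by
  have hB := quB_mem hm
  have h1B : 0 < 1 - quB m := by linarith [hB.2]
  have hΦ := quPhi_pos hm
  have hA := (quA_pos hm).ne'
  have he2 : m * (m - 1) + 1 ≠ 0 := by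
    have : 0 < m * (m - 1) + 1 := by nlinarith [sq_nonneg (m - 1 / 2)]
    exact this.ne'
  have he := (ReflectionThird.sq_sub_add_one_pos m).ne'
  rw [betaFun, show (((1 - y : ℚ)) : ℝ) - 1 = ((-1:ℤ) : ℝ) * (y : ℝ) + 0 by push_cast; ring,
    show (((4 * y : ℚ)) : ℝ) - 1 = ((4:ℤ) : ℝ) * (y : ℝ) + (-1) by push_cast; ring,
    qu_master hB.1 h1B, qt_keyB hm, Real.inv_rpow hΦ.le, ← Real.rpow_neg hΦ.le,
    Real.rpow_zero, Real.rpow_neg_one, one_sub_quB, abs_of_pos (quB'_pos hm)]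
  unfold qsGB quB'
  field_simp

/-- **Pull-back along `ψ`:** `G_C = s^{-3y}(1-s)^{y-1/2}|ψ'|`, `s = ψ(m)`. -/
theorem qs_pullC (y : ℚ) {m : ℝ} (hm : m ∈ Ioo (0:ℝ) 1) :
    qsGC y m = betaFun (1 - 3 * y) (1 / 2 + y) (quS m) * |quS' m| := by
  have hS := quS_mem hm
  have h1S := one_sub_quS_pos hm
  have hΦ := quPhi_pos hm
  have h1 : (1:ℝ) - m ≠ 0 := by linarith [hm.2]
  rw [betaFun, show (((1 - 3 * y : ℚ)) : ℝ) - 1 = ((-3:ℤ) : ℝ) * (y : ℝ) + 0 by push_cast; ring,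
    show (((1 / 2 + y : ℚ)) : ℝ) - 1 = ((1:ℤ) : ℝ) * (y : ℝ) + (-(1 / 2 : ℝ)) by push_cast; ring,
    qu_master hS.1 h1S, qt_keyC hm, Real.inv_rpow (by positivity),
    Real.mul_rpow (by norm_num) hΦ.le, mul_inv, ← Real.rpow_neg hΦ.le,
    ← Real.rpow_neg (by norm_num : (0:ℝ) ≤ 64), Real.rpow_zero, qu_sqrtC hm,
    abs_of_pos (quS'_pos hm)]
  unfold qsGC quS'
  field_simp

/-! ## Integrability -/

/-- `G_A` is integrable on `(0,1)` for `0 < y < 1/4`. -/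
theorem integrableOn_qsGA (y : ℚ) (hy : 0 < y) (hy4 : 4 * y < 1) :
    IntegrableOn (qsGA y) (Ioo 0 1) := by
  have h := integrableOn_betaFun (4 * y) (1 - 3 * y) (by positivity) (by linarith)
  rw [image_quA, integrableOn_image_iff_integrableOn_abs_deriv_smul measurableSet_Ioo
    (fun m _ => (hasDerivAt_quA m).hasDerivWithinAt) injOn_quA] at h
  exact h.congr_fun (fun m hm => by simp only [smul_eq_mul]; rw [mul_comm, ← qs_pullA y hm])
    measurableSet_Ioo

/-- `G_B` is integrable on `(0,1)` for `0 < y < 1/4`. -/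
theorem integrableOn_qsGB (y : ℚ) (hy : 0 < y) (hy4 : 4 * y < 1) :
    IntegrableOn (qsGB y) (Ioo 0 1) := by
  have h := integrableOn_betaFun (1 - y) (4 * y) (by linarith) (by positivity)
  rw [image_quB, integrableOn_image_iff_integrableOn_abs_deriv_smul measurableSet_Ioo
    (fun m _ => (hasDerivAt_quB m).hasDerivWithinAt) injOn_quB] at h
  exact h.congr_fun (fun m hm => by simp only [smul_eq_mul]; rw [mul_comm, ← qs_pullB y hm])
    measurableSet_Ioo

/-- `G_C` is integrable on `(0,1)` for `0 < y < 1/4`. -/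
theorem integrableOn_qsGC (y : ℚ) (hy : 0 < y) (hy4 : 4 * y < 1) :
    IntegrableOn (qsGC y) (Ioo 0 1) := by
  have h := integrableOn_betaFun (1 - 3 * y) (1 / 2 + y) (by linarith) (by positivity)
  rw [image_quS, integrableOn_image_iff_integrableOn_abs_deriv_smul measurableSet_Ioo
    (fun m _ => (hasDerivAt_quS m).hasDerivWithinAt) injOn_quS] at h
  exact h.congr_fun (fun m hm => by simp only [smul_eq_mul]; rw [mul_comm, ← qs_pullC y hm])
    measurableSet_Ioo

/-! ## Semialgebraicity -/

/-- `Φ^{-y} · p(m) / r(m)` is `ℚ`-semialgebraic on `(0,1)` for polynomials `p`, `r`, `r ≠ 0`. -/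
theorem sa_qs_shape (y : ℚ) (p r : MvPolynomial (Fin 1) ℚ)
    (hr : ∀ v ∈ line (Ioo (0:ℝ) 1), aeval v r ≠ 0) :
    IsSemialgebraicFunOn ℚ (line (Ioo (0:ℝ) 1))
      (fun v : Fin 1 → ℝ => quPhi (v 0) ^ (-(y : ℝ)) * aeval v p / aeval v r) :=
  IsSemialgebraicFunOn.div
    (IsSemialgebraicFunOn.mul_holds ((sa_quPhi_rpow (-y)).congr fun v _ => by push_cast; rfl)
      (isSemialgebraicFunOn_aeval mix_line_sa p))
    (isSemialgebraicFunOn_aeval mix_line_sa r) hr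

/-- `G_A` is `ℚ`-semialgebraic on `(0,1)`. -/
theorem sa_qsGA (y : ℚ) :
    IsSemialgebraicFunOn ℚ (line (Ioo (0:ℝ) 1)) (fun v : Fin 1 → ℝ => qsGA y (v 0)) :=
  (sa_qs_shape y (3 * X 0 ^ 2 - 2 * X 0 + 1) ((1 - X 0) * (1 + X 0 ^ 2)) qt_aeval_A_ne_zero).congr
    fun v _ => by simp [qsGA, quA]

/-- `G_B` is `ℚ`-semialgebraic on `(0,1)`. -/
theorem sa_qsGB (y : ℚ) :
    IsSemialgebraicFunOn ℚ (line (Ioo (0:ℝ) 1)) (fun v : Fin 1 → ℝ => qsGB y (v 0)) :=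
  (sa_qs_shape y (X 0 ^ 2 * (X 0 ^ 2 - 2 * X 0 + 3)) ((1 - X 0) * (1 + X 0 ^ 2) * (X 0 ^ 2 - X 0 + 1))
    fun v hv => by
      rw [map_mul]
      exact mul_ne_zero (qt_aeval_A_ne_zero v hv) (by
        simpa using (ReflectionThird.sq_sub_add_one_pos (v 0)).ne')).congr
    fun v _ => by simp [qsGB, quA, mul_assoc]

/-- `G_C` is `ℚ`-semialgebraic on `(0,1)`. -/
theorem sa_qsGC (y : ℚ) :
    IsSemialgebraicFunOn ℚ (line (Ioo (0:ℝ) 1)) (fun v : Fin 1 → ℝ => qsGC y (v 0)) :=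
  (IsSemialgebraicFunOn.mul_holds
    (isSemialgebraicFunOn_const_of_isAlgebraic mix_line_sa (qu_isAlgebraic_rpow (-y)))
    (sa_qs_shape y (4 * (1 + X 0) * (1 - X 0)) ((1 + X 0 ^ 2) ^ 2) fun v _ => by
      have : (0:ℝ) < (1 + v 0 ^ 2) ^ 2 := by positivity
      simpa using this.ne')).congr fun v _ => by simp [qsGC]

/-- The exact integrand is `ℚ`-semialgebraic on the OPEN interval. -/
theorem sa_qsE_Ioo (y : ℚ) :
    IsSemialgebraicFunOn ℚ (line (Ioo (0:ℝ) 1)) (fun v : Fin 1 → ℝ => qsE y (v 0)) := by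
  refine (((isSemialgebraicFunOn_const_of_isAlgebraic mix_line_sa
      (isAlgebraic_rat ℚ ((1 - 4 * y) / 4))).mul_holds
      ((isSemialgebraicFunOn_const_of_isAlgebraic mix_line_sa (qu_isAlgebraic_rpow y)).mul_holds
        (sa_qsGC y))).add_holds
    (((isSemialgebraicFunOn_const_of_isAlgebraic mix_line_sa
      (isAlgebraic_rat ℚ (-(3 * y)))).mul_holds (sa_qsGB y)).add_holds
      ((isSemialgebraicFunOn_const_of_isAlgebraic mix_line_sa
        (isAlgebraic_rat ℚ y)).mul_holds (sa_qsGA y)))).congr fun v hv => ?_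
  have hv' : v 0 ∈ Ioo (0:ℝ) 1 := hv
  simp only [qsE, if_pos hv', Pi.add_apply, Pi.mul_apply]

/-! ## The primitive -/

/-- `P(0) = 0` (`y < 1/3`). -/
theorem qsP_zero (hy3 : 3 * y < 1) : qsP y 0 = 0 := by
  have h : (1 - 3 * (y : ℝ)) ≠ 0 := by
    have : (3 * y : ℝ) < 1 := by exact_mod_cast hy3
    linarith
  simp [qsP, Real.zero_rpow h]

/-- `P(1) = 0` (`y ≠ 0`). -/
theorem qsP_one (hy : 0 < y) : qsP y 1 = 0 := by
  have h : (4 * (y : ℝ)) ≠ 0 := by positivity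
  simp [qsP, Real.zero_rpow h]

/-- `P` is continuous (`0 < y < 1/3`). -/
theorem continuous_qsP (hy : 0 < y) (hy3 : 3 * y < 1) : Continuous (qsP y) := by
  have h4 : (0:ℝ) ≤ 4 * (y : ℝ) := by positivity
  have h13 : (0:ℝ) ≤ 1 - 3 * (y : ℝ) := by
    have : (3 * y : ℝ) < 1 := by exact_mod_cast hy3
    linarith
  unfold qsP
  refine Continuous.div ?_ ?_ fun m => (Real.rpow_pos_of_pos (ReflectionThird.sq_sub_add_one_pos m) _).ne'
  · refine ((Continuous.rpow_const (by fun_prop) fun _ => Or.inr h4).mul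
      (Continuous.rpow_const (by fun_prop) fun m => Or.inl ?_)).mul
      (Continuous.rpow_const continuous_id fun _ => Or.inr h13)
    positivity
  · exact Continuous.rpow_const (by fun_prop) fun m => Or.inl (ReflectionThird.sq_sub_add_one_pos m).ne'

/-- On `(0,1)`: `P = Φ^{-y}·m/(1+m²)`. -/
theorem qsP_eq {m : ℝ} (hm : m ∈ Ioo (0:ℝ) 1) :
    qsP y m = quPhi m ^ (-(y : ℝ)) * (m / (1 + m ^ 2)) := by
  have hA := quA_pos hm
  have hD := quD_pos hm
  have hΦ := quPhi_pos hm
  have h0 := hm.1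
  have h1 : (0:ℝ) < 1 - m := by linarith [hm.2]
  have he := ReflectionThird.sq_sub_add_one_pos m
  have h2 : (0:ℝ) < 1 + m ^ 2 := by positivity
  rw [Real.rpow_neg hΦ.le, ← Real.inv_rpow hΦ.le,
    show (quPhi m)⁻¹ = quA m ^ 4 / quD m ^ 3 by rw [quPhi, inv_div],
    Real.div_rpow (pow_nonneg hA.le 4) (pow_nonneg hD.le 3), ← Real.rpow_natCast (quA m) 4,
    ← Real.rpow_mul hA.le, ← Real.rpow_natCast (quD m) 3, ← Real.rpow_mul hD.le,
    show quA m = (1 - m) * (1 + m ^ 2) from rfl, show quD m = m * (m ^ 2 - m + 1) from rfl,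
    Real.mul_rpow h1.le h2.le, Real.mul_rpow h0.le he.le]
  unfold qsP
  rw [Real.rpow_sub h2, Real.rpow_sub h0, Real.rpow_one, Real.rpow_one]
  push_cast
  have hp1 := Real.rpow_pos_of_pos h2 (4 * (y:ℝ))
  have hp2 := Real.rpow_pos_of_pos h0 (3 * (y:ℝ))
  have hp3 := Real.rpow_pos_of_pos he (3 * (y:ℝ))
  field_simp

/-- `D' = 3m²-2m+1`. -/
theorem hasDerivAt_quD (m : ℝ) : HasDerivAt quD (3 * m ^ 2 - 2 * m + 1) m := by
  have he : HasDerivAt (fun z : ℝ => z ^ 2 - z + 1) (2 * m - 1) m := by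
    simpa using ((hasDerivAt_pow 2 m).sub (hasDerivAt_id m)).add_const 1
  refine ((hasDerivAt_id' m).mul he).congr_deriv ?_
  ring

/-- `Φ' ` is the derivative of `Φ` on `(0,1)`. -/
theorem hasDerivAt_quPhi {m : ℝ} (hm : m ∈ Ioo (0:ℝ) 1) : HasDerivAt quPhi (quPhi' m) m := by
  have hA := (quA_pos hm).ne'
  refine (((hasDerivAt_quD m).fun_pow 3).div ((hasDerivAt_quA m).fun_pow 4)
    (pow_ne_zero 4 hA)).congr_deriv ?_
  unfold quPhi' quA'
  field_simp
  ring

/-- `Φ'/Φ = (3m²-2m+1)(3A+4D)/(AD)` on `(0,1)`. -/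
theorem quPhi'_div {m : ℝ} (hm : m ∈ Ioo (0:ℝ) 1) :
    quPhi' m / quPhi m = (3 * m ^ 2 - 2 * m + 1) * (3 * quA m + 4 * quD m) / (quA m * quD m) := by
  have hA := (quA_pos hm).ne'
  have hD := (quD_pos hm).ne'
  rw [div_eq_div_iff (quPhi_pos hm).ne' (mul_ne_zero hA hD)]
  unfold quPhi' quPhi
  field_simp

/-- **`P' = ((1-4y)/4)64^y G_C - 3y G_B + y G_A` on `(0,1)`** — the Newton–Leibniz identity of
the second-kind quartic splitting. -/
theorem hasDerivAt_qsP {m : ℝ} (hm : m ∈ Ioo (0:ℝ) 1) : HasDerivAt (qsP y) (qsE y m) m := by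
  obtain ⟨h0, h1⟩ := hm
  have hΦ := quPhi_pos ⟨h0, h1⟩
  have hA := (quA_pos ⟨h0, h1⟩).ne'
  have hD := (quD_pos ⟨h0, h1⟩).ne'
  have he := (ReflectionThird.sq_sub_add_one_pos m).ne'
  have h2 : (1:ℝ) + m ^ 2 ≠ 0 := by positivity
  have h64 : (64:ℝ) ^ (y : ℝ) ≠ 0 := by positivity
  have hF : qsP y =ᶠ[nhds m] fun v => quPhi v ^ (-(y : ℝ)) * (v / (1 + v ^ 2)) :=
    Filter.eventually_iff_exists_mem.mpr ⟨Ioo 0 1, Ioo_mem_nhds h0 h1, fun v hv => qsP_eq hv⟩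
  have hd2 : HasDerivAt (fun v : ℝ => 1 + v ^ 2) (2 * m) m := by
    simpa using (hasDerivAt_pow 2 m).const_add 1
  have hρ : HasDerivAt (fun v : ℝ => v / (1 + v ^ 2))
      ((1 * (1 + m ^ 2) - m * (2 * m)) / (1 + m ^ 2) ^ 2) m := (hasDerivAt_id' m).div hd2 h2
  refine ((((hasDerivAt_quPhi ⟨h0, h1⟩).rpow_const (p := -(y : ℝ)) (Or.inl hΦ.ne')).mul
    hρ).congr_of_eventuallyEq hF).congr_deriv ?_
  rw [qsE, if_pos ⟨h0, h1⟩]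
  simp only [qsGA, qsGB, qsGC]
  rw [Real.rpow_sub_one hΦ.ne', Real.rpow_neg (by norm_num : (0:ℝ) ≤ 64) (y : ℝ),
    mul_inv_cancel_left₀ h64]
  set L := quPhi m ^ (-(y : ℝ)) with hL
  have key : quPhi' m * (-(y : ℝ)) * (L / quPhi m) * (m / (1 + m ^ 2)) =
      -(y : ℝ) * L * ((3 * m ^ 2 - 2 * m + 1) * (3 * quA m + 4 * quD m) / (quA m * quD m)) *
        (m / (1 + m ^ 2)) := by
    rw [← quPhi'_div ⟨h0, h1⟩]
    ring
  rw [key]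
  unfold quA quD at *
  have h1m : (1:ℝ) - m ≠ 0 := by linarith
  push_cast
  set q := m ^ 2 - m + 1 with hq
  field_simp
  rw [hq]
  ring

end SoloBlind

end Summit.KontsevichZagierPeriods.KontsevichZagierPeriods.Theorems
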